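import Literature.IUT.HodgeArakelov.CohomologySystemOfContH1
import Literature.AnabelianGeometry.EtaleTheta.ThetaEnvOfSetting

/-!
# Bridge: [IUTchII] Prop 1.4's output `EtaleThetaData` at the MODEL `Π = Π^tp_{X̲̲}`, from [EtTh] §1–§2 (L2)

MERGE-MAP (plan/L6/MERGE-MAP.md) §2, row `MonoThetaFromGroups.lean :251,:275 EtaleThetaData, .thetaInfty`
↔ L2-t1 `ThetaSetting.EtaleThetaData` (landed): "IMPORT when it lands". S. Mochizuki, *Inter-universal
Teichmüller theory II*, kurims manuscript (Dec. 2020), Prop. 1.4 p. 27: "the open subgroup `Π_Ÿ(Π) ⊆ Π`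
corresponding to the tempered covering `Ÿ` [cf. the discussion preceding [EtTh], Definition 2.7] and a certain
subquotient `(l·Δ_Θ)(Π)` of `Π` …, as well as … the set `θ(Π) ⊆ H¹(Π_Ÿ(Π), (l·Δ_Θ)(Π))` of `μ_l`-multiples
… of the reciprocal of the `(l·ℤ × μ_2)`-orbit `η̈^{Θ,l·ℤ×μ_2}` of an `l`-th root of the étale theta function
of standard type of [EtTh], Definition 2.7 … `J` ranges over the finite index open subgroups of `Π`."

The landed interface (abc-iut-L6-t1, `MonoThetaFromGroups.lean` p406189) is `EtaleThetaData S P` over a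
[IUTchII] setting `S` and a topological group `P ≅ Π^tp_{X̲̲_k}`. HERE it is INSTANTIATED at the genuine group
`P := Π^tp_X̲̲` of [EtTh] §2 — abc-iut-L2-t8's choice `C : E.DoubleUnderline l` of the covering `X̲̲ → X` over
abc-iut-L2-t1's §1 root `D : EtaleTheta.ThetaSetting p` and étale theta class data `E : D.EtaleThetaData`
(`Π^tp_X̲̲ = C.Huu ⊆ Π^tp_X`, `Π^tp_Ÿ̲̲ = Π^tp_Ÿ ∩ Π^tp_X̲̲ = C.GtpYdduu`, `l·Δ_Θ = D.lDeltaTheta l`):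
* `PiYdd :=` `Π^tp_Ÿ̲̲` viewed inside `Π^tp_X̲̲`; open by L2-t8's `isOpen_GtpYdd` (under `K = K̈`, `D.Sec2Hyps`);
* `lDeltaTheta :=` the subquotient `φ⁻¹(l·Δ_Θ)/Ker φ` of `Π^tp_X̲̲`, `φ : Π^tp_X̲̲ → (Π^tp_X)^Θ`;
* `coh :=` `cohomologySystemOfContH1 φ (l·Δ_Θ) Π^tp_Ÿ̲̲` — REAL continuous cohomology `H¹(Π^tp_Ÿ̲̲ ∩ J, l·Δ_Θ)`
  with its direct limit over finite-index open `J` (`CohomologySystemOfContH1.lean`);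
* `orbit :=` the classes in `H¹(Π^tp_Ÿ̲̲, l·Δ_Θ)` of L2-t8's `l·Δ_Θ`-valued lifts `C.rootCocycles hC` of the
  `Π^tp_X̲̲ (↠ (l·ℤ)×μ₂)`-orbit of `η̈^Θ|_{Π^tp_Ÿ̲̲}` ([EtTh] Def. 2.7 p. 41: "the class `η̈^Θ` determines a class
  `η̲̈^Θ ∈ H¹(Π^tp_Ÿ̲̲, l·Δ_Θ)` … [an] `l`-th root"), transported into `coh.H1 ⊤` by `h1EquivOfFiniteIndexOpen`;
  nonempty by `C.eta_res`;
* `theta` DEFINED by the interface's own equation (`theta_eq := rfl`).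
INPUTS THAT STAY HYPOTHESES (named, quoted): (H1) `PiYddCharacteristic C` — "corresponding to the tempered
covering `Ÿ`" in the [EtTh] Cor. 2.18 (i) form the interface demands (`PiYdd_corresponds`: EVERY isomorphism
`Π ≅ Π^tp_{X̲̲_k}` carries `Π_Ÿ(Π)` to the reference subgroup) amounts, at the model, to: every topological
automorphism of `Π^tp_X̲̲` stabilises `Π^tp_Ÿ̲̲` — tempered anabelian input ([EtTh] Cor. 2.18 (i) / [SemiAnbd]),
not proved here; (H2) the [IUTchII] setting `S` with an identification `eS : Π^tp_X̲̲ ≃ S.PiX` and `S.l = l`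
(abc-iut-L6-d6's bridge B8 `ThetaSetting.ofThetaEnvData` produces such `S`; kept as parameters so that this
file does not depend on it). NOT imposed: "of standard type" ([EtTh] Def. 1.9/2.7 normalisation of the class
— abc-iut-L2-t1's `IsOfStandardType`; the construction is uniform in the class `E.etaDd`, the consumer adds the
predicate). Claim key of the interface `Mochizuki2012` (D-0012, disputed); [EtTh] is refereed; this file is a
CONSTRUCTION over the landed files — typed ≠ any claim on [IUTchIII] Cor. 3.12.
-/

namespace Literature.IUT.HodgeArakelov

open Literature.AnabelianGeometry.EtaleTheta (ContH1 contCocycles)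
open CohomologySystemOfContH1

noncomputable section

namespace EtaleThetaDataOfSetting

variable {p : ℕ} [Fact p.Prime] {D : Literature.AnabelianGeometry.EtaleTheta.ThetaSetting p}
  {E : D.EtaleThetaData} {l : ℕ} (C : E.DoubleUnderline l)

/-- `l·Δ_Θ` is commutative (a subgroup of the commutative `Δ_Θ`). [cite: MochizukiEtTh2009, Prop 2.12 (i) p.45] -/
instance instIsMulCommutative_lDeltaTheta (l : ℕ) : IsMulCommutative (D.lDeltaTheta l) :=
  ⟨⟨fun a b => Subtype.ext
    (D.ker_thetaToEll_comm a.1 (D.lDeltaTheta_le l a.2) b.1 (D.lDeltaTheta_le l b.2))⟩⟩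

/-- `Π := Π^tp_X̲̲` as a bundled topological group (the [IUTchII] `TopGroup`). [cite: Mochizuki2012, Prop 1.4 p.27] -/
abbrev Pi : TopGroup.{0} := TopGroup.mk C.Huu

/-- `φ : Π^tp_X̲̲ → (Π^tp_X)^Θ`, through which `Π^tp_X̲̲` acts on `l·Δ_Θ` by conjugation. [cite: MochizukiEtTh2009, §1 p.12] -/
abbrev phi : (Pi C) →* D.GtpTheta := D.toTheta.comp C.Huu.subtype

/-- `Π_Ÿ(Π) := Π^tp_Ÿ̲̲ = Π^tp_Ÿ ∩ Π^tp_X̲̲`, as a subgroup of `Π^tp_X̲̲`. [cite: Mochizuki2012, Prop 1.4 p.27] -/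
abbrev PiYdd : Subgroup (Pi C) := C.GtpYdduu.subgroupOf C.Huu

/-- `Π^tp_Ÿ̲̲ ⊆ Π^tp_X̲̲` is open (L2-t8: `Π^tp_Ÿ` open under `K = K̈`; `Π^tp_X̲̲` open). [cite: Mochizuki2012, Prop 1.4 p.27] -/
theorem isOpen_PiYdd (hS : D.Sec2Hyps) : IsOpen (PiYdd C : Set (Pi C)) := by
  have h : IsOpen ((C.GtpYdduu : Set D.PiTemp)) :=
    (Literature.AnabelianGeometry.EtaleTheta.ThetaSetting.EtaleThetaData.DoubleUnderline.isOpen_GtpYdd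
      hS).inter C.isOpen_Huu
  exact h.preimage continuous_subtype_val

/-- **(H1) `PiYddCharacteristic`**: every topological automorphism of `Π^tp_X̲̲` stabilises `Π^tp_Ÿ̲̲` — the
model content of the interface clause "`Π_Ÿ(Π)` corresponding to the tempered covering `Ÿ`" in its [EtTh]
Cor. 2.18 (i) form (tempered anabelian rigidity; NOT proved here — named hypothesis).
[cite: Mochizuki2012, Prop 1.4 p.27] -/
def PiYddCharacteristic : Prop :=
  ∀ α : (Pi C) ≃ₜ* (Pi C), (PiYdd C).map α.toMulEquiv.toMonoidHom = PiYdd C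

/-- The subquotient `(l·Δ_Θ)(Π)` of `Π = Π^tp_X̲̲`: `φ⁻¹(l·Δ_Θ) / Ker φ` (DEFINED; its carrier maps onto
`l·Δ_Θ ⊆ φ(Π^tp_X̲̲)` by `C.map_toTheta_Huu`). [cite: Mochizuki2012, Prop 1.4 p.27] -/
def lDeltaSubquotient : Subquotient (Pi C) where
  top := (D.lDeltaTheta l).comap (phi C)
  bot := (phi C).ker
  le := by
    intro x hx
    rw [MonoidHom.mem_ker] at hx
    rw [Subgroup.mem_comap, hx]
    exact one_mem _
  normal := inferInstance

/-- The inclusion `Π_Ÿ(Π) ∩ J → Π^tp_Ÿ̲̲` (as subgroups of `Π^tp_X̲̲` and of `Π^tp_X`). [cite: Mochizuki2012, Prop 1.4 p.27] -/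
def toYdduu (J : Subgroup (Pi C)) : ↥(PiYdd C ⊓ J) →* ↥C.GtpYdduu where
  toFun x := ⟨((x : Pi C) : D.PiTemp), Subgroup.mem_subgroupOf.mp (Subgroup.mem_inf.mp x.2).1⟩
  map_one' := rfl
  map_mul' _ _ := rfl

/-- `toYdduu` is continuous. [cite: Mochizuki2012, Prop 1.4 p.27] -/
theorem continuous_toYdduu (J : Subgroup (Pi C)) : Continuous (toYdduu C J) :=
  Continuous.subtype_mk (continuous_subtype_val.comp continuous_subtype_val) _

/-- An `l·Δ_Θ`-valued continuous `Δ_Θ`-cocycle on `Π^tp_Ÿ̲̲` (a member of `C.rootCocycles hC`), read as an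
`l·Δ_Θ`-COEFFICIENT cocycle on `Π_Ÿ(Π) ∩ J ⊆ Π^tp_X̲̲`. [cite: MochizukiEtTh2009, Def 2.7 p.41] -/
def liftCocycle (J : Subgroup (Pi C)) (f : ↥C.GtpYdduu → ↥D.DeltaTheta)
    (hval : ∀ g, (f g : D.GtpTheta) ∈ D.lDeltaTheta l) : ↥(PiYdd C ⊓ J) → ↥(D.lDeltaTheta l) :=
  fun x => ⟨(f (toYdduu C J x) : D.GtpTheta), hval _⟩

/-- `liftCocycle` of a continuous cocycle is a continuous cocycle. [cite: MochizukiEtTh2009, Def 2.7 p.41] -/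
theorem liftCocycle_mem (J : Subgroup (Pi C)) (f : ↥C.GtpYdduu → ↥D.DeltaTheta)
    (hf : f ∈ contCocycles D.toTheta D.DeltaTheta C.GtpYdduu)
    (hval : ∀ g, (f g : D.GtpTheta) ∈ D.lDeltaTheta l) :
    liftCocycle C J f hval ∈ contCocycles (phi C) (D.lDeltaTheta l) (PiYdd C ⊓ J) := by
  refine ⟨Continuous.subtype_mk (continuous_subtype_val.comp (hf.1.comp (continuous_toYdduu C J))) _,
    fun g h => ?_⟩
  apply Subtype.ext
  have key := congrArg (fun a : ↥D.DeltaTheta => (a : D.GtpTheta)) (hf.2 (toYdduu C J g) (toYdduu C J h))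
  simpa [liftCocycle, toYdduu, MulAut.conjNormal_apply] using key

/-- The class in `H¹(Π^tp_Ÿ̲̲ ∩ ⊤, l·Δ_Θ)` of a root cocycle. [cite: MochizukiEtTh2009, Def 2.7 p.41] -/
def rootClass (f : contCocycles D.toTheta D.DeltaTheta C.GtpYdduu)
    (hval : ∀ g, (f.1 g : D.GtpTheta) ∈ D.lDeltaTheta l) :
    ContH1 (phi C) (D.lDeltaTheta l) (PiYdd C ⊓ ⊤) :=
  ContH1.mk (liftCocycle C ⊤ f.1 hval) (liftCocycle_mem C ⊤ f.1 f.2 hval)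

/-- The cohomology system `J ↦ H¹(Π_Ÿ(Π)|_J, (l·Δ_Θ)(Π))` at the model: REAL continuous cohomology with
coefficients `l·Δ_Θ` and its direct limit over finite-index open `J` (`CohomologySystemOfContH1`).
[cite: Mochizuki2012, Prop 1.4 p.27] -/
abbrev coh : CohomologySystem (Pi C) :=
  cohomologySystemOfContH1 (phi C) (D.lDeltaTheta l) (PiYdd C)

/-- The comparison `coh.H1 ⊤ ≅ H¹(Π^tp_Ÿ̲̲ ∩ ⊤, l·Δ_Θ)` (`⊤` is finite-index open). [cite: Mochizuki2012, Prop 1.4 p.27] -/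
abbrev h1Top : (coh C).H1 ⊤ ≃+ Additive (ContH1 (phi C) (D.lDeltaTheta l) (PiYdd C ⊓ ⊤)) :=
  h1EquivOfFiniteIndexOpen (phi C) (D.lDeltaTheta l) (PiYdd C) ⊤ inferInstance (by simp)

/-- **The orbit `η̈^{Θ,l·ℤ×μ₂}`** of [IUTchII] Prop. 1.4 at the model: the classes in `H¹(Π^tp_Ÿ̲̲, l·Δ_Θ)` of the
`l·Δ_Θ`-valued lifts (L2-t8 `rootCocycles`: "`η̈^Θ` determines a class `η̲̈^Θ ∈ H¹(Π^tp_Ÿ̲̲, l·Δ_Θ)`", an `l`-th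
root) of the `Π^tp_X̲̲/Π^tp_Ÿ̲̲ ≅ (l·ℤ)×μ₂`-orbit of the étale theta class `η̈^Θ`, inside `coh.H1 ⊤` (DEFINED).
[cite: Mochizuki2012, Prop 1.4 p.27] -/
def orbit (hC : D.Compat) : Set ((coh C).H1 ⊤) :=
  {y | ∃ (f : contCocycles D.toTheta D.DeltaTheta C.GtpYdduu) (hf : f ∈ C.rootCocycles hC),
    y = (h1Top C).symm (Additive.ofMul (rootClass C f hf.1))}

/-- The orbit is nonempty: `η̈^Θ|_{Π^tp_Ÿ̲̲}` itself has an `l·Δ_Θ`-valued lift (`C.eta_res`, [EtTh] p. 41).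
[cite: MochizukiEtTh2009, Def 2.7 p.41] -/
theorem orbit_nonempty (hC : D.Compat) : (orbit C hC).Nonempty := by
  obtain ⟨f, hf, hval, hmk⟩ := C.eta_res
  haveI := hC.GtpYdd_normal
  have hroot : (⟨f, hf⟩ : contCocycles D.toTheta D.DeltaTheta C.GtpYdduu) ∈ C.rootCocycles hC := by
    refine ⟨hval, 1, one_mem _, ?_⟩
    rw [Literature.AnabelianGeometry.EtaleTheta.ThetaSetting.EtaleThetaData.DoubleUnderline.contH1_conj_one]
    exact hmk
  exact ⟨_, ⟨f, hf⟩, hroot, rfl⟩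

end EtaleThetaDataOfSetting

open EtaleThetaDataOfSetting

/-- **The bridge**: [IUTchII] Prop. 1.4's OUTPUT `EtaleThetaData S Π` INSTANTIATED at the model
`Π := Π^tp_X̲̲` from [EtTh] §1–§2 (L2), under the named hypotheses (H1) `PiYddCharacteristic C` and (H2) an
identification `eS : Π^tp_X̲̲ ≃ S.PiX` with a [IUTchII] setting `S` (for `S.l = l`, `θ(Π)` reads as printed:
`etaleThetaDataOfSetting_theta`); every other field is
CONSTRUCTED (open subgroup, subquotient, REAL cohomology system, orbit of root classes, `θ(Π)` by its
defining equation). [cite: Mochizuki2012, Prop 1.4 p.27] -/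
def etaleThetaDataOfSetting {p : ℕ} [Fact p.Prime]
    {D : Literature.AnabelianGeometry.EtaleTheta.ThetaSetting p} {E : D.EtaleThetaData} {l : ℕ}
    (C : E.DoubleUnderline l) (hC : D.Compat) (hS : D.Sec2Hyps) (hchar : PiYddCharacteristic C)
    (S : ThetaSetting.{0}) (eS : (Pi C) ≃ₜ* S.PiX) : EtaleThetaData S (Pi C) where
  isoRef := ⟨eS⟩
  PiYddRef := (PiYdd C).map eS.toMulEquiv.toMonoidHom
  PiYdd := PiYdd C
  isOpen_PiYdd := isOpen_PiYdd C hS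
  PiYdd_corresponds e := by
    -- `e = eS ∘ (eS⁻¹ ∘ e)` and `eS⁻¹ ∘ e` stabilises `Π^tp_Ÿ̲̲` by (H1)
    have hα := hchar (e.trans eS.symm)
    calc (PiYdd C).map e.toMulEquiv.toMonoidHom
        = ((PiYdd C).map (e.trans eS.symm).toMulEquiv.toMonoidHom).map eS.toMulEquiv.toMonoidHom := by
          rw [Subgroup.map_map]
          congr 1
          ext x
          change e x = eS (eS.symm (e x))
          rw [ContinuousMulEquiv.apply_symm_apply]
      _ = (PiYdd C).map eS.toMulEquiv.toMonoidHom := by rw [hα]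
  lDeltaTheta := lDeltaSubquotient C
  coh := coh C
  orbit := orbit C hC
  orbit_nonempty := orbit_nonempty C hC
  theta := {b | ∃ o ∈ orbit C hC, (S.l : ℕ) • (b + o) = 0}
  theta_eq := rfl

/-- Unfolding: the bridge's cohomology system IS the real one. [cite: Mochizuki2012, Prop 1.4 p.27] -/
theorem etaleThetaDataOfSetting_coh {p : ℕ} [Fact p.Prime]
    {D : Literature.AnabelianGeometry.EtaleTheta.ThetaSetting p} {E : D.EtaleThetaData} {l : ℕ}
    (C : E.DoubleUnderline l) (hC : D.Compat) (hS : D.Sec2Hyps) (hchar : PiYddCharacteristic C)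
    (S : ThetaSetting.{0}) (eS : (Pi C) ≃ₜ* S.PiX) :
    (etaleThetaDataOfSetting C hC hS hchar S eS).coh = coh C := rfl

/-- Unfolding: `θ(Π)` at the model is the set of `μ_l`-multiples of the reciprocals of the root classes, with
the SAME `l` as the covering `X̲̲` (via `S.l = l`). [cite: Mochizuki2012, Prop 1.4 p.27] -/
theorem etaleThetaDataOfSetting_theta {p : ℕ} [Fact p.Prime]
    {D : Literature.AnabelianGeometry.EtaleTheta.ThetaSetting p} {E : D.EtaleThetaData} {l : ℕ}
    (C : E.DoubleUnderline l) (hC : D.Compat) (hS : D.Sec2Hyps) (hchar : PiYddCharacteristic C)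
    (S : ThetaSetting.{0}) (eS : (Pi C) ≃ₜ* S.PiX) (hl : S.l = l) :
    (etaleThetaDataOfSetting C hC hS hchar S eS).theta =
      {b | ∃ o ∈ orbit C hC, l • (b + o) = 0} := by
  change {b | ∃ o ∈ orbit C hC, (S.l : ℕ) • (b + o) = 0} = _
  rw [hl]


/-! ## v2 (append-only; RQ7 audit abc-iut-w4-d013 2026-08-25T23:30:07Z, F1/F3): the orbit of ONE `l`-th root

F1 (statement-sizing): `orbit C hC` above collects the classes of ALL `l·Δ_Θ`-valued lifts (`C.rootCocycles` is,
by L2-t8's own reading note, "the union of those (at most `l`) translates"), i.e. the `(l·ℤ × μ_2)`-orbits of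
ALL `l`-th roots of `η̈^Θ`, whereas print (p. 27 l. 9) says "the `(l·ℤ × μ_2)`-orbit `η̈^{Θ,l·ℤ×μ_2}` of AN `l`-th
root" — one orbit; the landed interface's docstring for `orbit` ("its members differ by NON-torsion classes")
also means ONE orbit. `θ(Π)` (the `μ_l`-multiples of the reciprocals) is the same for both. REPAIR (primed
decls, nothing above edited): `rootLift` = ONE chosen `l·Δ_Θ`-valued lift of `η̈^Θ|_{Π^tp_Ÿ̲̲}` (from
`C.eta_res`), `orbitOne` = its `Π^tp_X̲̲ (↠ Π^tp_X̲̲/Π^tp_Ÿ̲̲ ≅ (l·ℤ)×μ₂)`-conjugacy orbit in `H¹(Π^tp_Ÿ̲̲, l·Δ_Θ)`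
(L2's `ContH1.conj` on the normal subgroup `Π^tp_Ÿ̲̲ ⊴ Π^tp_X̲̲`), `etaleThetaDataOfSetting'` = the bridge with
`orbit := orbitOne` and — F3 — WITH the binder `S.l = l` in its signature (so `θ(Π)` reads with the covering's
`l` for every admissible `S`). F2 (the hypothesis `PiYddCharacteristic C` IS the `Π^tp_Ÿ`-conjunct of L2-t2's
named fact `RigidData.Cor218_i` at L2-t8's `C.rigidData`) is w4-d013's to land (L2 `Discharge/` companion);
the node's closing half (S := abc-iut-L6-d6's `ThetaSetting.ofDoubleUnderline`, standard type, `∞θ`) is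
abc-iut-w4-d025's (L6-lead §F v1.8 (3)). -/

namespace EtaleThetaDataOfSetting

variable {p : ℕ} [Fact p.Prime] {D : Literature.AnabelianGeometry.EtaleTheta.ThetaSetting p}
  {E : D.EtaleThetaData} {l : ℕ} (C : E.DoubleUnderline l)

/-- `Π^tp_Ÿ̲̲ ⊴ Π^tp_X̲̲`: normal (as `Π^tp_Ÿ ⊴ Π^tp_X` under `D.Compat`, L2-t1 `Compat.GtpYdd_normal`), hence so is
`Π^tp_Ÿ̲̲ ∩ J` for normal `J` (used with `J = ⊤`). [cite: MochizukiEtTh2009, Def 2.7 p.41] -/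
theorem piYdd_normal (hC : D.Compat) : (PiYdd C).Normal := by
  haveI := hC.GtpYdd_normal
  have h : PiYdd C = D.GtpYdd.subgroupOf C.Huu := by
    ext x
    simp only [Subgroup.mem_subgroupOf, Subgroup.mem_inf, and_iff_left_iff_imp]
    exact fun _ => x.2
  rw [h]
  infer_instance

/-- **ONE chosen `l`-th root**: an `l·Δ_Θ`-valued continuous cocycle on `Π^tp_Ÿ̲̲` representing
`η̈^Θ|_{Π^tp_Ÿ̲̲}` ([EtTh] p. 41 "the class `η̈^Θ` determines a class `η̲̈^Θ ∈ H¹(Π^tp_Ÿ̲̲, l·Δ_Θ)`"; the choice,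
from `C.eta_res`, is "up to multiplication by a root of unity of order `l`", Cor. 2.8 (i)).
[cite: MochizukiEtTh2009, Def 2.7 p.41] -/
def rootLift : contCocycles D.toTheta D.DeltaTheta C.GtpYdduu :=
  ⟨Classical.choose C.eta_res, Classical.choose (Classical.choose_spec C.eta_res)⟩

/-- The chosen lift takes values in `l·Δ_Θ`. [cite: MochizukiEtTh2009, Def 2.7 p.41] -/
theorem rootLift_val : ∀ g, ((rootLift C).1 g : D.GtpTheta) ∈ D.lDeltaTheta l :=
  (Classical.choose_spec (Classical.choose_spec C.eta_res)).1

/-- The chosen lift represents `η̈^Θ|_{Π^tp_Ÿ̲̲}` in `H¹(Π^tp_Ÿ̲̲, Δ_Θ)`. [cite: MochizukiEtTh2009, Def 2.7 p.41] -/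
theorem rootLift_mk : ContH1.mk (rootLift C).1 (rootLift C).2 =
    ContH1.res D.toTheta D.DeltaTheta inf_le_left E.etaDd :=
  (Classical.choose_spec (Classical.choose_spec C.eta_res)).2

/-- The class `η̲̈^Θ ∈ H¹(Π^tp_Ÿ̲̲ ∩ ⊤, l·Δ_Θ)` of the chosen `l`-th root. [cite: MochizukiEtTh2009, Def 2.7 p.41] -/
def rootLiftClass : ContH1 (phi C) (D.lDeltaTheta l) (PiYdd C ⊓ ⊤) :=
  rootClass C (rootLift C) (rootLift_val C)

/-- **The orbit `η̈^{Θ,l·ℤ×μ₂}` of ONE `l`-th root** ([IUTchII] Prop. 1.4 p. 27 l. 9, verbatim sizing): the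
`Π^tp_X̲̲`-conjugacy orbit (the action factors through `Π^tp_X̲̲/Π^tp_Ÿ̲̲ ≅ (l·ℤ) × μ₂`, [EtTh] p. 41) of the class
of the chosen root in `H¹(Π^tp_Ÿ̲̲, l·Δ_Θ)`, transported into `coh.H1 ⊤` (DEFINED; replaces `orbit` for the
node's closing half). [cite: Mochizuki2012, Prop 1.4 p.27] -/
def orbitOne (hC : D.Compat) : Set ((coh C).H1 ⊤) :=
  haveI := piYdd_normal C hC
  {y | ∃ σ : Pi C,
    y = (h1Top C).symm (Additive.ofMul (ContH1.conj (phi C) (D.lDeltaTheta l) σ (rootLiftClass C)))}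

/-- The one-root orbit is nonempty (`σ = 1`). [cite: Mochizuki2012, Prop 1.4 p.27] -/
theorem orbitOne_nonempty (hC : D.Compat) : (orbitOne C hC).Nonempty :=
  ⟨_, 1, rfl⟩

end EtaleThetaDataOfSetting

/-- **The bridge, v2 (primed)**: as `etaleThetaDataOfSetting`, with `orbit :=` the orbit of ONE `l`-th root
(`orbitOne`, print's sizing, audit F1) and WITH the binder `S.l = l` (audit F3), under the same named inputs
(H1) `PiYddCharacteristic C`, (H2) `eS`. [cite: Mochizuki2012, Prop 1.4 p.27] -/
def etaleThetaDataOfSetting' {p : ℕ} [Fact p.Prime]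
    {D : Literature.AnabelianGeometry.EtaleTheta.ThetaSetting p} {E : D.EtaleThetaData} {l : ℕ}
    (C : E.DoubleUnderline l) (hC : D.Compat) (hS : D.Sec2Hyps) (hchar : PiYddCharacteristic C)
    (S : ThetaSetting.{0}) (eS : (Pi C) ≃ₜ* S.PiX) (_hl : S.l = l) : EtaleThetaData S (Pi C) where
  isoRef := ⟨eS⟩
  PiYddRef := (PiYdd C).map eS.toMulEquiv.toMonoidHom
  PiYdd := PiYdd C
  isOpen_PiYdd := isOpen_PiYdd C hS
  PiYdd_corresponds := (etaleThetaDataOfSetting C hC hS hchar S eS).PiYdd_corresponds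
  lDeltaTheta := lDeltaSubquotient C
  coh := coh C
  orbit := orbitOne C hC
  orbit_nonempty := orbitOne_nonempty C hC
  theta := {b | ∃ o ∈ orbitOne C hC, (S.l : ℕ) • (b + o) = 0}
  theta_eq := rfl

/-- Unfolding (v2): the cohomology system is the real one. [cite: Mochizuki2012, Prop 1.4 p.27] -/
theorem etaleThetaDataOfSetting'_coh {p : ℕ} [Fact p.Prime]
    {D : Literature.AnabelianGeometry.EtaleTheta.ThetaSetting p} {E : D.EtaleThetaData} {l : ℕ}
    (C : E.DoubleUnderline l) (hC : D.Compat) (hS : D.Sec2Hyps) (hchar : PiYddCharacteristic C)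
    (S : ThetaSetting.{0}) (eS : (Pi C) ≃ₜ* S.PiX) (hl : S.l = l) :
    (etaleThetaDataOfSetting' C hC hS hchar S eS hl).coh = coh C := rfl

/-- Unfolding (v2): the orbit is the one-root orbit. [cite: Mochizuki2012, Prop 1.4 p.27] -/
theorem etaleThetaDataOfSetting'_orbit {p : ℕ} [Fact p.Prime]
    {D : Literature.AnabelianGeometry.EtaleTheta.ThetaSetting p} {E : D.EtaleThetaData} {l : ℕ}
    (C : E.DoubleUnderline l) (hC : D.Compat) (hS : D.Sec2Hyps) (hchar : PiYddCharacteristic C)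
    (S : ThetaSetting.{0}) (eS : (Pi C) ≃ₜ* S.PiX) (hl : S.l = l) :
    (etaleThetaDataOfSetting' C hC hS hchar S eS hl).orbit = orbitOne C hC := rfl

/-- Unfolding (v2): `θ(Π)` = the `μ_l`-multiples of the reciprocals of the one-root orbit, with the covering's
`l`. [cite: Mochizuki2012, Prop 1.4 p.27] -/
theorem etaleThetaDataOfSetting'_theta {p : ℕ} [Fact p.Prime]
    {D : Literature.AnabelianGeometry.EtaleTheta.ThetaSetting p} {E : D.EtaleThetaData} {l : ℕ}
    (C : E.DoubleUnderline l) (hC : D.Compat) (hS : D.Sec2Hyps) (hchar : PiYddCharacteristic C)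
    (S : ThetaSetting.{0}) (eS : (Pi C) ≃ₜ* S.PiX) (hl : S.l = l) :
    (etaleThetaDataOfSetting' C hC hS hchar S eS hl).theta =
      {b | ∃ o ∈ orbitOne C hC, l • (b + o) = 0} := by
  change {b | ∃ o ∈ orbitOne C hC, (S.l : ℕ) • (b + o) = 0} = _
  rw [hl]

end

end Literature.IUT.HodgeArakelov
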